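import Summits.NavierStokesRegularity.NavierStokesRegularity.Theses.PalasekTowerBreakdown
import Summits.NavierStokesRegularity.FluidComputer.PalasekTowerBoxSchedule
import Summits.NavierStokesRegularity.FluidComputer.PalasekTowerHeredityWitnessUnconditional
import Literature.Analysis.FluidPDE.NSQuasipotential

/-!
# `HeredityAtOne`: the level-1 FLOOR is load-bearing — the zero design and
# `heredityAtOne_false_without_floorAtOne`

Cell `ns-blowup`, seat `refuter-ns-palasek-19249-disprove-1` (DISPROVER on the route `PalasekTowerBreakdown`,
item stmt-NavierStokesRegularity-19249 `HeredityAtOne`). NEGATIVE-LANE lemmas, UNCONDITIONAL and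
sorry-free (load-bearing analysis of the crux in the sense of the disprover protocol: «any proof must use
`H`»). Companion of `HeredityAtOneFalseOfCappedStageAtOne.lean` / `…NoSwirlCappedStageAtOne.lean` (same
seat: conditional cap levers).

`HeredityAtOne` quantifies over REGISTERED level-1 stages `s : Stage 1 wide S routeG 1`: classical
finite-energy solutions of the design's forced system on `[0, τ₁]` from `S.u₀` that carry the register's
FLOORS `c₁ Y_j ≤ ‖u(τ_j, x_j)‖` (`j ≤ 1`), ceilings, timing and margin. This file shows that the FLOOR
is the load-bearing clause of that binder:

* `zeroDesign` — the pinned (`Λ = 8`, `θ = 6/5`) rigid quiet wide design with ZERO datum and ZERO force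
  (`Schedule.ofBox 0 0 0 0`): an honest member of the item's `∀ S` range (`zeroDesign_pins`,
  `zeroDesign_rigid`, `zeroDesign_quiet`);
* `isEmpty_stage_zeroDesign` — it registers NOTHING: at every level `k` and for every margin the stage
  type is empty (forced uniqueness `Stage.velocity_eq_of_classical` against the rest state
  `isClassicalNSSolutionOn_zero` gives `u(τ_k) = 0`, against the floor `c₁ Y_k > 0`); so `HeredityAt k`
  holds VACUOUSLY on it (`heredityAt_zeroDesign`) — the ∀-form is true «for lack of instances» on
  every design whose level-`k` register is empty, which today is every design anyone can write down;
* `HeredityAtWithoutFloor k` — `HeredityAt k` with the level-`k` object stripped of its floors / timing /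
  margin (keeping: classical on `[0, τ_k]`, datum `S.u₀`, finite energy, the ceiling `c₂ Y_k`) — is FALSE
  at every level: `heredityAtWithoutFloor_false`, at `k = 1` `heredityAtOne_false_without_floorAtOne`,
  witnessed by the rest state on `zeroDesign` (a level-`(k+1)` stage would have to read `c₁ Y_{k+1} > 0`
  at `τ_{k+1}` while being identically zero). The stripped form is STRONGER than `HeredityAt k`
  (`not_heredityAtWithoutFloor_of_not_heredityAt`, contrapositive form), so this is a genuine weakening of
  the hypothesis, not a change of subject.

READING: a disproof of `HeredityAtOne` must PRODUCE a registered level-1 stage (the floor `c₁ Y₁` at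
`τ₁` reached from the ceiling `c₂ Y₀` inside the window — `EpisodeBaseG`-type content), and a proof may
use nothing about the host but that registration. WHAT THIS IS NOT: not Navier–Stokes evidence; the
zero design is junk by intent (it isolates the clause), no verdict changes.

References: S. Palasek, arXiv:2605.13827 §3.3–§4 [cite: Palasek2026ElementaryModel, §4]; H. Sohr,
The Navier–Stokes equations (2001), Ch. V Thm. 1.5.1 (uniqueness) [cite: Sohr2001, Ch. V Thm. 1.5.1].
-/

noncomputable section

namespace Summit.NavierStokesRegularity.HeredityAtOneZeroDesign

open Set MeasureTheory Function
open scoped ENNReal ContDiff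
open Literature.Analysis.FluidPDE
open Summit.NavierStokesRegularity.FluidComputer.PalasekTowerClayBridge
open Summit.NavierStokesRegularity.NavierStokesRegularity

/-! ## §1 The zero design -/

/-- **The zero design**: the box schedule (`PalasekTowerBoxSchedule`: rigid window clock, `c₁ = 1`,
`c₂ = 5/3`, `c₅ = 4bβ`) with datum `0`, force `0`, radius `0`, push constant `0`.
[cite: Palasek2026ElementaryModel, §3.3] -/
def zeroDesign : Schedule TowerRates.wide :=
  Schedule.ofBox 0 0 0 0 zero_le_one contDiff_const HasCompactSupport.zero
    (by simpa only [show uncurry (0 : ℝ → EuclideanSpace ℝ (Fin 3) → EuclideanSpace ℝ (Fin 3)) =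
      fun _ => 0 from rfl] using contDiff_const)
    (by simpa only [show uncurry (0 : ℝ → EuclideanSpace ℝ (Fin 3) → EuclideanSpace ℝ (Fin 3)) =
      (0 : ℝ × EuclideanSpace ℝ (Fin 3) → EuclideanSpace ℝ (Fin 3)) from rfl]
      using HasCompactSupport.zero)
    (fun _ _ _ => rfl) (fun _ _ _ => by simp)

/-- The zero design's force is `0`. [folklore] -/
@[simp] theorem zeroDesign_f : zeroDesign.f = 0 := rfl

/-- The zero design's datum is `0`. [folklore] -/
@[simp] theorem zeroDesign_u₀ : zeroDesign.u₀ = 0 := rfl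

/-- The zero design's floor constant is `1`. [folklore] -/
@[simp] theorem zeroDesign_c₁ : zeroDesign.c₁ = 1 := rfl

/-- The zero design is RIGID. [folklore] -/
theorem zeroDesign_rigid : zeroDesign.Rigid := Schedule.ofBox_rigid _ _ _ _ _ _ _

/-- The zero design is QUIET. [folklore] -/
theorem zeroDesign_quiet : zeroDesign.Quiet := Schedule.ofBox_quiet _ _ _ _ _ _ _

/-- The zero design is PINNED with `Λ = 8`, `θ = 6/5`. [folklore] -/
theorem zeroDesign_pins : zeroDesign.Pins 8 (6 / 5) :=
  Schedule.ofBox_pins _ _ _ _ _ _ _ (fun _ _ => rfl) (fun _ _ _ => rfl)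

/-- **The rest state solves the zero design's system** on every time set. [folklore] -/
theorem zero_isClassical (T : Set ℝ) :
    IsClassicalNSSolutionOn T 1 zeroDesign.f (0 : ℝ → EuclideanSpace ℝ (Fin 3) → EuclideanSpace ℝ (Fin 3))
      0 := by
  rw [zeroDesign_f]
  exact isClassicalNSSolutionOn_zero T 1

/-- **The zero design registers nothing**: its stage type is EMPTY at every level and for every margin
(uniqueness against the rest state versus the floor `c₁ Y_k > 0`). [cite: Sohr2001, Ch. V Thm. 1.5.1] -/
theorem isEmpty_stage_zeroDesign (m : Margins TowerRates.wide) (k : ℕ) :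
    IsEmpty (Stage 1 TowerRates.wide zeroDesign m k) := by
  refine ⟨fun s => ?_⟩
  have hE : ∃ C : ℝ≥0∞, C < ⊤ ∧ ∀ t ∈ Icc 0 (zeroDesign.τ k),
      ∫⁻ x, ‖(0 : ℝ → EuclideanSpace ℝ (Fin 3) → EuclideanSpace ℝ (Fin 3)) t x‖ₑ ^ 2 ≤ C :=
    ⟨0, ENNReal.zero_lt_top, fun t _ => by simp⟩
  have h0 := s.velocity_eq_of_classical one_pos le_rfl (zero_isClassical _) (by simp) hE (zeroDesign.τ k)
    ⟨(zeroDesign.τ_pos k).le, le_rfl⟩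
  obtain ⟨x, -, hfl⟩ := s.floor k le_rfl
  rw [← h0, zeroDesign_c₁] at hfl
  have hY : 0 < TowerRates.wide.Y k := Real.rpow_pos_of_pos (TowerRates.wide.N_pos k) _
  simp only [Pi.zero_apply, norm_zero, one_mul] at hfl
  exact absurd hfl (not_le.2 hY)

/-- **`HeredityAt k` holds VACUOUSLY on the zero design** (no level-`k` stage to extend) — the ∀-form
is true for lack of instances wherever the register is empty. [cite: Palasek2026ElementaryModel, §4] -/
theorem heredityAt_zeroDesign (k : ℕ)
    (s : Stage 1 TowerRates.wide zeroDesign (Margins.routeG TowerRates.wide) k) :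
    ∃ s' : Stage 1 TowerRates.wide zeroDesign (Margins.routeG TowerRates.wide) (k + 1), s.Extends s' :=
  (isEmpty_stage_zeroDesign _ k).elim s

/-! ## §2 The floor is load-bearing -/

/-- **`HeredityAt k` WITHOUT the level-`k` registration** (the level-`k` object stripped to: classical
solution of the design's system on `[0, τ_k]` from `S.u₀`, finite energy, ceiling `c₂ Y_k` on the slab;
floors, timing and margin dropped): every such flow of a pinned rigid quiet wide design is continued by a
registered level-`(k+1)` stage. At `k = 1` this is `HeredityAtOne` with the first rung's floor removed.
[cite: Palasek2026ElementaryModel, §4] -/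
def HeredityAtWithoutFloor (k : ℕ) : Prop :=
  ∀ S : Schedule TowerRates.wide, S.Pins 8 (6 / 5) → S.Rigid → S.Quiet →
    ∀ (u : ℝ → EuclideanSpace ℝ (Fin 3) → EuclideanSpace ℝ (Fin 3))
      (p : ℝ → EuclideanSpace ℝ (Fin 3) → ℝ),
      IsClassicalNSSolutionOn (Icc 0 (S.τ k)) 1 S.f u p → u 0 = S.u₀ →
      (∃ C : ℝ≥0∞, C < ⊤ ∧ ∀ t ∈ Icc 0 (S.τ k), ∫⁻ x, ‖u t x‖ₑ ^ 2 ≤ C) →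
      (∀ t ∈ Icc 0 (S.τ k), ∀ x, ‖u t x‖ ≤ S.c₂ * TowerRates.wide.Y k) →
      ∃ s' : Stage 1 TowerRates.wide S (Margins.routeG TowerRates.wide) (k + 1),
        ∀ t ∈ Icc 0 (S.τ k), s'.u t = u t ∧ s'.p t = p t

/-- The stripped form is STRONGER than heredity at the same level (it only weakens the hypothesis on
the level-`k` object): every refutation of `HeredityAt k` (`HeredityAt 1 = HeredityAtOne`,
`heredityAtOne_iff`) refutes it too. Stated contrapositively so that this Negative-lane file asserts no
route item positively. [cite: Palasek2026ElementaryModel, §4] -/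
theorem not_heredityAtWithoutFloor_of_not_heredityAt {k : ℕ} (hn : ¬ HeredityAt k) :
    ¬ HeredityAtWithoutFloor k := fun h =>
  hn fun S hP hR hQ s => by
    obtain ⟨s', hs'⟩ := h S hP hR hQ s.u s.p s.classical s.initial s.energy (s.ceiling k le_rfl)
    exact ⟨s', hs'⟩

/-- **The level-`k` floor is load-bearing: heredity without it is FALSE at every level** — the rest
state on the zero design is a finite-energy classical solution under the ceiling, and no level-`(k+1)`
stage of the zero design exists (`isEmpty_stage_zeroDesign`). [cite: Sohr2001, Ch. V Thm. 1.5.1] -/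
theorem heredityAtWithoutFloor_false (k : ℕ) : ¬ HeredityAtWithoutFloor k := by
  intro h
  have hY : 0 < TowerRates.wide.Y k := Real.rpow_pos_of_pos (TowerRates.wide.N_pos k) _
  have hc₂ : zeroDesign.c₂ = 5 / 3 := rfl
  obtain ⟨s', -⟩ := h zeroDesign zeroDesign_pins zeroDesign_rigid zeroDesign_quiet 0 0
    (zero_isClassical _) (by simp) ⟨0, ENNReal.zero_lt_top, fun t _ => by simp⟩
    (fun t _ x => by rw [hc₂]; simp; positivity)
  exact (isEmpty_stage_zeroDesign _ (k + 1)).false s'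

/-- **`HeredityAtOne` without the first rung's floor is FALSE** (`k = 1`). [cite: Sohr2001, Ch. V Thm. 1.5.1] -/
theorem heredityAtOne_false_without_floorAtOne : ¬ HeredityAtWithoutFloor 1 :=
  heredityAtWithoutFloor_false 1

end Summit.NavierStokesRegularity.HeredityAtOneZeroDesign

end
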